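import Literature.NumberTheory.Irrationality.LaiLupuSprang2025.ExpansionLemmas
import Literature.NumberTheory.Irrationality.LaiLupuSprang2025.PhiFactor
import HarnessLib

/-!
# Lai–Lupu–Sprang 2025, Lemma 6.1: the expansion of `R_n(t + j/p)` at `t = 0`, `R_n(t+j/p) = p^{(p+1+s)(n+1)−M₀−2}·n!^s·P(t)Q(t)`,
# and the bound `v_p(∫_{ℤ_p}(R̃_n(t+j/p) − R̃_n(j/p))dt) ≥ (p+1+s)(n+1) + s·v_p(n!) − M₀ − 3 − log_p(n+1)` — PROVED

Topic `Literature/NumberTheory/Irrationality/LaiLupuSprang2025`.  Source: L. Lai, C. Lupu, J. Sprang, *On the irrationality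
of certain `p`-adic zeta values*, Res. Math. Sci. 12 (2025) = arXiv:2505.23088 [LaiLupuSprang2025], §6, Lemma 6.1 with
(6.1)–(6.5), and the first display of the proof of Lemma 6.3 (`S_{j/p} = −𝓛_1(R_n(t+j/p)) − R̃_n(j/p)`, Lemma 2.4) (held text
`paper:arxiv-2505.23088`, chunk p0009, read on the page).  PROOF FILE (definitions with bodies + theorems; no named fact,
net debt 0): fifth file of the discharge of `PAdicZetaValues.laiLupuSprang2025_theorem11`, on `RationalFunction.lean` (`Rn`,
`coeffR`, `Rn_eq_sum_coeffR`), `LinearForms.lean` (`Rtil`, `Sj`, `Lx`), `ExpansionLemmas.lean` and the tree's `pTaylor`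
calculus (`Transcendental/TaylorSeriesPadic.lean`).

## Source, as printed ([LaiLupuSprang2025, Lemma 6.1 and proof of Lemma 6.3])

**Lemma 6.1.** «For any `j ∈ {1,…,p−1}`, we have `R_n(t+j/p) ∈ C^{an}(ℤ_p,ℚ_p)` and
`v_p(𝓛_1(R_n(t + j/p))) ≥ (p+1+s)(n+1) + s·v_p(n!) − M₀ − 3 − ⌊log(n+1)/log p⌋`.»  *Proof.* «By (def:R_n(t)), we can rewrite
`R_n(t) = p^{pn}·n!^s·t^{M₀}·∏_{ν=1}^{p−1}∏_{m=0}^{n−1}(t+m+ν/p)/(t)_{n+1}^{p−1+s}`.  Thus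
`R_n(t+j/p) = p^{(p+1+s)(n+1)−M₀−2}·n!^s × ∏_{m<n}(t+m+1) × (pt+j)^{M₀}·∏_{ν≠p−j}∏_{m<n}(pt+pm+j+ν) × ∏_{m≤n}(pt+pm+j)^{−(p−1+s)}`
[(6.1)–(6.4)].  Clearly, the factors in the lines (6.3) and (6.4) belong to `ℤ_p⟦pt⟧`.  Thus `R_n(t+j/p) = p^{…}·n!^s·P(t)·Q(t)`
[(6.5)] where `P(t) ∈ ℤ[t]` is the polynomial in the line (6.2), and `Q(t) ∈ ℤ_p⟦pt⟧`.  Let us write `R_n(t+j/p) = Σ_k u_k t^k`.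
Noting that `deg P = n`, we deduce … `v_p(u_k) ≥ (p+1+s)(n+1) + s·v_p(n!) − M₀ − 2 + max{0, k−n}` … Therefore
`v_p(𝓛_1(R_n(t+j/p))) = v_p(Σ_k u_k B_{k+1}/(k+1)) ≥ … − M₀ − 3 − ⌊log(n+1)/log p⌋`.»
Proof of Lemma 6.3, first display: «By Definition 4.2 and Lemma 2.4 [`𝓛_1(f′) = ∫_{ℤ_p} f(t)dt − f(0)`], we have
`S_{j/p} = −𝓛_1(R_n(t+j/p)) − R̃_n(j/p)`.»

## What is formalised (all PROVED; `p` an odd prime, `1 ≤ j < p`, `s ≥ 1`, degree condition of Lemma 4.1)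

* `Fint p s n u := R_n(u/p)` (the «integral model»: `R_n(t + j/p) = Fint(j + pt)`), its product form `Fint_eq_prod`/`FintProd` ((6.1)–(6.4)
  before expanding) and its partial fractions `Fint_eq_sum` (`= Σ r_{i,k} p^i (u+pk)^{−i}`, from (def:r_ik)).
* `poleSer p s n j := pTaylor p (Fint p s n) j = Σ_k u_k X^k ∈ ℚ⟦X⟧` — **the expansion `R_n(t+j/p) = Σ u_k t^k`**; (6.5) as
  `poleSer_eq_prod` with `P = ∏_{m<n}(C(m+1) + X)` and `Q ∈ ℤ_p⟦pX⟧` (`psOrdGeS_poleQ`), and the bound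
  **`padicOrdGe_coeff_poleSer`**: `v_p(u_k) ≥ (p+1+s)(n+1) − M₀ − 2 + s·v_p(n!) + (k − n)` (and `≥ … + 0`).
* `poleSer_eq_sum`: `Σ u_k X^k = Σ_{k,i} r_{i,k} p^i (invLin p (j+pk))^i` (divided derivatives of the partial fractions), and the
  primitive `polePrim` (`Σ_k r_{1,k} logSer p (j+pk) + Σ_{i≥2} (r_{i,k}/(1−i)) p^{i−1}((invLin)^{i−1} − const)`) with
  `derivative_polePrim = poleSer`, `coeff_polePrim_succ` (`[X^{k+1}] = u_k/(k+1)`).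
* **The analytic bridge**: `hasSum_polePrim` — for `t ∈ ℤ_p`, `R̃_n(t + j/p) − R̃_n(j/p) = Σ_{k≥0} (u_k/(k+1)) t^{k+1}`
  (`Rtil p s n j t − Rtil p s n j 0`; logarithmic and binomial series of `ExpansionLemmas.lean`), `norm_coeff_polePrim_le`
  (`‖u_k/(k+1)‖_p ≤ (n+1)·p^{−((p+1+s)(n+1)−M₀−2)}·‖n!‖_p^s`, the «`max{0,k−n} − v_p(k+1)`» bookkeeping) and
  **Lemma 6.1 / Lemma 2.4**: `Sj_add_Rtil_zero_eq` (`S_{j/p} + R̃_n(j/p) = −Σ_k B_{k+1}u_k/(k+1)`, the tree's term-by-term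
  Volkenborn integration) with the bound `norm_Sj_add_Rtil_zero_le`:
  `‖S_{j/p} + R̃_n(j/p)‖_p ≤ p(n+1)·p^{−((p+1+s)(n+1)−M₀−2)}·‖n!‖_p^s`.

Cell zeta5-irr / pub-zeta5 (HONEST FRAMING: systematic search; no irrationality claim unless kernel-certified): `p`-adic
bookkeeping of a PUBLISHED proof; nothing here bears on `ζ(5) ∈ ℝ`.
-/

noncomputable section

open Finset Filter Topology PowerSeries
open scoped Nat
open Literature.NumberTheory.Transcendental
open Literature.NumberTheory.LocalFields
open Literature.Analysis.Calculus (divDeriv divDeriv_congr divDeriv_const_mul divDeriv_sum)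

namespace Literature.NumberTheory.Irrationality.LaiLupuSprang2025

/-! ## §1. The integral model `Fint(u) = R_n(u/p)` and its two shapes -/

/-- `Fint p s n u := R_n(u/p)`, so that `R_n(t + j/p) = Fint(j + pt)` — the substitution behind (6.1)–(6.4).
[cite: LaiLupuSprang2025, Lemma 6.1 (6.1)–(6.4)] -/
def Fint (p s n : ℕ) (u : ℚ) : ℚ := Rn p s n (u / p)

/-- The exponent `(p+s)(n+1) − M₀ − 1 = n + (n+1)(p−1+s) − M₀` of the integral model (before the extra `p^n` of the line
(6.2)); together `E' + n = (p+1+s)(n+1) − M₀ − 2`. [cite: LaiLupuSprang2025, Lemma 6.1 (6.1) and Lemma 6.2 (P(t))] -/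
def Eexp (p s n : ℕ) : ℕ := n + (n + 1) * (p - 1 + s) - M0 p s

/-- **Product form of the integral model** ((6.1)–(6.4) before splitting off `ν = p − j`): for every `u` (at the poles both
sides are `0` by the `x/0 = 0` convention),
`R_n(u/p) = p^{E'}·n!^s·u^{M₀}·∏_{ν=1}^{p−1}∏_{m<n}(u + (pm+ν)) · (∏_{m≤n}(u+pm)^{p−1+s})^{−1}`, `E' = n + (n+1)(p−1+s) − M₀`.
[cite: LaiLupuSprang2025, Lemma 6.1 (6.1)–(6.4)] -/
theorem Fint_eq_prod {p : ℕ} (hp : 1 ≤ p) (s n : ℕ) (hM : M0 p s ≤ n + (n + 1) * (p - 1 + s)) (u : ℚ) :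
    Fint p s n u = (p : ℚ) ^ Eexp p s n * (n ! : ℚ) ^ s * u ^ M0 p s *
      (∏ ν ∈ Ico 1 p, ∏ m ∈ range n, (u + ((p * m + ν : ℕ) : ℚ))) *
        ((∏ l ∈ range (n + 1), (u + ((p * l : ℕ) : ℚ))) ^ (p - 1 + s))⁻¹ := by
  have hp0 : (p : ℚ) ≠ 0 := by exact_mod_cast (show p ≠ 0 by omega)
  unfold Fint Rn
  -- rewrite each factor of `R_n(u/p)` over the common denominator `p`
  have h1 : (u / p) ^ M0 p s = u ^ M0 p s / (p : ℚ) ^ M0 p s := div_pow _ _ _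
  have h2 : ∏ j ∈ Ico 1 p, ∏ m ∈ range n, (u / p + ((j : ℚ) / p + m)) =
      (∏ ν ∈ Ico 1 p, ∏ m ∈ range n, (u + ((p * m + ν : ℕ) : ℚ))) / (p : ℚ) ^ ((p - 1) * n) := by
    have hfac : ∀ ν ∈ Ico 1 p, ∏ m ∈ range n, (u / p + ((ν : ℚ) / p + m)) =
        (∏ m ∈ range n, (u + ((p * m + ν : ℕ) : ℚ))) / (p : ℚ) ^ n := by
      intro ν _
      rw [eq_div_iff (pow_ne_zero _ hp0), ← card_range n, ← prod_const, card_range, ← prod_mul_distrib]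
      refine prod_congr rfl fun m _ => ?_
      push_cast
      field_simp
      ring
    rw [prod_congr rfl hfac, prod_div_distrib, prod_const, Nat.card_Ico, ← pow_mul, mul_comm n]
  have h3 : (∏ m ∈ range (n + 1), (u / p + m)) ^ (p - 1 + s) =
      (∏ l ∈ range (n + 1), (u + ((p * l : ℕ) : ℚ))) ^ (p - 1 + s) / (p : ℚ) ^ ((n + 1) * (p - 1 + s)) := by
    have hfac : ∏ m ∈ range (n + 1), (u / p + m) = (∏ l ∈ range (n + 1), (u + ((p * l : ℕ) : ℚ))) / (p : ℚ) ^ (n + 1) := by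
      rw [eq_div_iff (pow_ne_zero _ hp0), ← card_range (n + 1), ← prod_const, card_range, ← prod_mul_distrib]
      refine prod_congr rfl fun l _ => ?_
      push_cast
      field_simp
    rw [hfac, div_pow, ← pow_mul]
  rw [h1, h2, h3]
  have hE : (p : ℚ) ^ (p * n) / (p : ℚ) ^ M0 p s / (p : ℚ) ^ ((p - 1) * n) * (p : ℚ) ^ ((n + 1) * (p - 1 + s)) =
      (p : ℚ) ^ Eexp p s n := by
    rw [Eexp, div_div, ← pow_add, div_mul_eq_mul_div, ← pow_add, div_eq_iff (pow_ne_zero _ hp0), ← pow_add]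
    congr 1
    obtain ⟨q, rfl⟩ : ∃ q, p = q + 1 := ⟨p - 1, by omega⟩
    have : (q + 1 - 1) * n + n = (q + 1) * n := by rw [Nat.add_sub_cancel]; ring
    omega
  rw [← hE]
  field_simp

/-- **Partial fractions of the integral model**: off the poles,
`R_n(u/p) = Σ_k Σ_i r_{i,k} p^i (u + pk)^{−i}` ((def:r_ik) with `(u/p + k)^{−i} = p^i(u+pk)^{−i}`).
[cite: LaiLupuSprang2025, Definition 3.2 (def:r_ik) and Lemma 6.1] -/
theorem Fint_eq_sum {p : ℕ} (hp : 1 ≤ p) (s n : ℕ) (hdeg : M0 p s + (p - 1) * n < (p - 1 + s) * (n + 1)) {u : ℚ}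
    (hu : ∀ l ∈ range (n + 1), u + p * l ≠ 0) :
    Fint p s n u = ∑ k ∈ range (n + 1), ∑ i ∈ Icc 1 (p - 1 + s),
      coeffR p s n i k * (p : ℚ) ^ i * ((u + ((p * k : ℕ) : ℚ)) ^ i)⁻¹ := by
  have hp0 : (p : ℚ) ≠ 0 := by exact_mod_cast (show p ≠ 0 by omega)
  have hu' : ∀ l ∈ range (n + 1), u / p + l ≠ 0 := by
    intro l hl h
    apply hu l hl
    have : u + p * l = p * (u / p + l) := by field_simp
    rw [this, h, mul_zero]
  unfold Fint
  rw [Rn_eq_sum_coeffR hp s n hdeg hu']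
  refine sum_congr rfl fun k _ => sum_congr rfl fun i _ => ?_
  have : u / p + k = (u + ((p * k : ℕ) : ℚ)) / p := by push_cast; field_simp
  rw [this, div_pow, inv_div, div_eq_mul_inv, mul_assoc]

/-- Near `u = j ≥ 1` there are no poles: `u + pl ≠ 0` for `|u − j| < 1/2`. [cite: LaiLupuSprang2025, Lemma 6.1 ("R_n(t+j/p) ∈ C^{an}(ℤ_p,ℚ_p)")] -/
theorem eventually_add_mul_ne_zero (p : ℕ) {j : ℕ} (hj : 1 ≤ j) (n : ℕ) :
    ∀ᶠ u : ℚ in 𝓝 (j : ℚ), ∀ l ∈ range (n + 1), u + (p : ℚ) * l ≠ 0 := by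
  rw [Metric.eventually_nhds_iff]
  refine ⟨1 / 2, by norm_num, fun u hu l _ => ?_⟩
  rw [Rat.dist_eq] at hu
  push_cast at hu
  have hj' : (1 : ℚ) ≤ j := by exact_mod_cast hj
  obtain ⟨h1, -⟩ := abs_lt.1 hu
  have hq : (((j : ℚ) - u : ℚ) : ℝ) < 1 / 2 := by push_cast; linarith
  have hq' : (j : ℚ) - u < 1 / 2 := by
    rw [show (1 / 2 : ℝ) = ((1 / 2 : ℚ) : ℝ) by norm_num] at hq
    exact_mod_cast hq
  have hu0 : 0 < u := by linarith
  have : (0 : ℚ) ≤ p * l := by positivity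
  linarith

/-! ## §2. The Taylor series `Σ u_k X^k` of `R_n(t + j/p)`: product form and the bound on `v_p(u_k)` -/

/-- **`Σ_k u_k X^k`**, the expansion of `R_n(t + j/p) = Fint(j + pt)` at `t = 0`, as the `p`-scaled Taylor series
`pTaylor p Fint j` of the tree. [cite: LaiLupuSprang2025, Lemma 6.1 ("Let us write R_n(t+j/p) = Σ_k u_k t^k")] -/
def poleSer (p s n j : ℕ) : ℚ⟦X⟧ := pTaylor p (Fint p s n) (j : ℚ)

/-- `pTaylor` of a constant multiple. [cite: LaiLupuSprang2025, Lemma 6.1 (6.5)] -/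
theorem pTaylor_const_mul (p : ℕ) (c : ℚ) (f : ℚ → ℚ) (x : ℚ) :
    pTaylor p (fun t => c * f t) x = C c * pTaylor p f x := by
  ext m
  rw [coeff_pTaylor, coeff_C_mul, coeff_pTaylor, divDeriv_const_mul]
  ring

/-- `pTaylor` of a finite sum of smooth functions. [cite: LaiLupuSprang2025, Lemma 6.1 (6.5)] -/
theorem pTaylor_finset_sum (p : ℕ) {ι : Type*} (S : Finset ι) {F : ι → ℚ → ℚ} {x : ℚ}
    (hF : ∀ i ∈ S, ContDiffAt ℚ (⊤ : ℕ∞) (F i) x) :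
    pTaylor p (fun t => ∑ i ∈ S, F i t) x = ∑ i ∈ S, pTaylor p (F i) x := by
  ext m
  rw [coeff_pTaylor, map_sum, divDeriv_sum fun i hi => (hF i hi).of_le (mod_cast le_top), mul_sum]
  refine sum_congr rfl fun i _ => ?_
  rw [coeff_pTaylor]

/-- `pTaylor` of two eventually equal functions agree. [cite: LaiLupuSprang2025, Lemma 6.1 (6.5)] -/
theorem pTaylor_congr (p : ℕ) {f g : ℚ → ℚ} {x : ℚ} (h : f =ᶠ[𝓝 x] g) : pTaylor p f x = pTaylor p g x := by
  ext m
  rw [coeff_pTaylor, coeff_pTaylor, divDeriv_congr h]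

/-- `(u + c)⁻¹` is smooth off `u = −c`. [cite: LaiLupuSprang2025, Lemma 6.1 ("R_n(t+j/p) ∈ C^{an}")] -/
theorem contDiffAt_inv_add {c x : ℚ} (h : x + c ≠ 0) {N : WithTop ℕ∞} : ContDiffAt ℚ N (fun u : ℚ => (u + c)⁻¹) x :=
  (contDiffAt_id.add contDiffAt_const).inv h

/-- **`Σ u_k X^k` through the partial fractions**: `poleSer = Σ_k Σ_i r_{i,k} p^i · (invLin p (j+pk))^i`
(the divided derivatives at `u = j` of `Σ r_{i,k}p^i(u+pk)^{−i}`). [cite: LaiLupuSprang2025, Lemma 6.1 with (def:r_ik)] -/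
theorem poleSer_eq_sum {p : ℕ} (hp : p.Prime) (s n : ℕ) (hdeg : M0 p s + (p - 1) * n < (p - 1 + s) * (n + 1))
    {j : ℕ} (hj : j ∈ Ico 1 p) :
    poleSer p s n j = ∑ k ∈ range (n + 1), ∑ i ∈ Icc 1 (p - 1 + s),
      C (coeffR p s n i k * (p : ℚ) ^ i) * invLin (p : ℚ) ((j : ℚ) + p * k) ^ i := by
  have hj1 : 1 ≤ j := (mem_Ico.1 hj).1
  have hne : ∀ k : ℕ, (j : ℚ) + ((p * k : ℕ) : ℚ) ≠ 0 := fun k => by positivity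
  have hev : Fint p s n =ᶠ[𝓝 (j : ℚ)] fun u => ∑ k ∈ range (n + 1), ∑ i ∈ Icc 1 (p - 1 + s),
      coeffR p s n i k * (p : ℚ) ^ i * ((u + ((p * k : ℕ) : ℚ)) ^ i)⁻¹ := by
    filter_upwards [eventually_add_mul_ne_zero p hj1 n] with u hu
    exact Fint_eq_sum hp.one_lt.le s n hdeg hu
  rw [poleSer, pTaylor_congr p hev, pTaylor_finset_sum p _ fun k _ => ?_]
  · refine sum_congr rfl fun k _ => ?_
    rw [pTaylor_finset_sum p _ fun i _ => ?_]
    · refine sum_congr rfl fun i _ => ?_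
      rw [pTaylor_const_mul]
      have e : (fun u : ℚ => ((u + ((p * k : ℕ) : ℚ)) ^ i)⁻¹) = fun u => ((u + ((p * k : ℕ) : ℚ))⁻¹) ^ i := by
        funext u; rw [inv_pow]
      rw [e, pTaylor_fun_pow (contDiffAt_inv_add (hne k)), pTaylor_inv_add_const p (hne k)]
      push_cast
      ring_nf
    · exact contDiffAt_const.mul ((contDiffAt_inv_add (hne k)).pow i |>.congr_of_eventuallyEq
        (Eventually.of_forall fun u => by simp [inv_pow]))
  · exact ContDiffAt.sum fun i _ => contDiffAt_const.mul ((contDiffAt_inv_add (hne k)).pow i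
      |>.congr_of_eventuallyEq (Eventually.of_forall fun u => by simp [inv_pow]))

/-- The product-form FUNCTION of (6.1)–(6.4): `p^{E'} n!^s (u+0)^{M₀} ∏_{ν,m}(u + (pm+ν)) ∏_l ((u+pl)^{−1})^{p−1+s}`.
[cite: LaiLupuSprang2025, Lemma 6.1 (6.1)–(6.4)] -/
def FintProd (p s n : ℕ) (u : ℚ) : ℚ :=
  (p : ℚ) ^ Eexp p s n * (n ! : ℚ) ^ s * (u + 0) ^ M0 p s *
    (∏ ν ∈ Ico 1 p, ∏ m ∈ range n, (u + ((p * m + ν : ℕ) : ℚ))) *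
      ∏ l ∈ range (n + 1), ((u + ((p * l : ℕ) : ℚ))⁻¹) ^ (p - 1 + s)

/-- `Fint = FintProd` (as functions). [cite: LaiLupuSprang2025, Lemma 6.1 (6.1)–(6.4)] -/
theorem Fint_eq_FintProd {p : ℕ} (hp : 1 ≤ p) (s n : ℕ) (hM : M0 p s ≤ n + (n + 1) * (p - 1 + s)) :
    Fint p s n = FintProd p s n := by
  funext u
  rw [Fint_eq_prod hp s n hM u, FintProd, add_zero, ← inv_pow, ← prod_inv_distrib, ← prod_pow]

/-- **(6.1)–(6.4) as a factorisation of `Σ u_k X^k` in `ℚ⟦X⟧`:**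
`poleSer = C(p^{E'}n!^s)·(C j + C p X)^{M₀}·∏_{ν,m}(C(j+pm+ν) + C p X)·∏_l (invLin p (j+pl))^{p−1+s}`.
[cite: LaiLupuSprang2025, Lemma 6.1 (6.1)–(6.5)] -/
theorem poleSer_eq_prod {p : ℕ} (hp : 1 ≤ p) (s n : ℕ) (hM : M0 p s ≤ n + (n + 1) * (p - 1 + s)) {j : ℕ}
    (hj : 1 ≤ j) :
    poleSer p s n j = C ((p : ℚ) ^ Eexp p s n * (n ! : ℚ) ^ s) * (C (j : ℚ) + C (p : ℚ) * X) ^ M0 p s *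
      (∏ ν ∈ Ico 1 p, ∏ m ∈ range n, (C ((j : ℚ) + ((p * m + ν : ℕ) : ℚ)) + C (p : ℚ) * X)) *
        ∏ l ∈ range (n + 1), invLin (p : ℚ) ((j : ℚ) + ((p * l : ℕ) : ℚ)) ^ (p - 1 + s) := by
  have hne : ∀ l : ℕ, (j : ℚ) + ((p * l : ℕ) : ℚ) ≠ 0 := fun l => by positivity
  -- smoothness of the blocks at `u = j`
  have h1 : ContDiffAt ℚ (⊤ : ℕ∞) (fun _ : ℚ => (p : ℚ) ^ Eexp p s n * (n ! : ℚ) ^ s) (j : ℚ) := contDiffAt_const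
  have h2 : ContDiffAt ℚ (⊤ : ℕ∞) (fun u : ℚ => (u + 0) ^ M0 p s) (j : ℚ) := by fun_prop
  have h3 : ContDiffAt ℚ (⊤ : ℕ∞) (fun u : ℚ => ∏ ν ∈ Ico 1 p, ∏ m ∈ range n, (u + ((p * m + ν : ℕ) : ℚ))) (j : ℚ) :=
    contDiffAt_prod fun ν _ => contDiffAt_prod fun m _ => by fun_prop
  have h4l : ∀ l ∈ range (n + 1), ContDiffAt ℚ (⊤ : ℕ∞) (fun u : ℚ => ((u + ((p * l : ℕ) : ℚ))⁻¹) ^ (p - 1 + s)) (j : ℚ) :=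
    fun l _ => (contDiffAt_inv_add (hne l)).pow _
  have h4 : ContDiffAt ℚ (⊤ : ℕ∞) (fun u : ℚ => ∏ l ∈ range (n + 1), ((u + ((p * l : ℕ) : ℚ))⁻¹) ^ (p - 1 + s)) (j : ℚ) :=
    contDiffAt_prod h4l
  rw [poleSer, Fint_eq_FintProd hp s n hM]
  have e : FintProd p s n = fun u => ((((fun _ : ℚ => (p : ℚ) ^ Eexp p s n * (n ! : ℚ) ^ s) u *
      (fun u : ℚ => (u + 0) ^ M0 p s) u) *
      (fun u : ℚ => ∏ ν ∈ Ico 1 p, ∏ m ∈ range n, (u + ((p * m + ν : ℕ) : ℚ))) u) *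
      (fun u : ℚ => ∏ l ∈ range (n + 1), ((u + ((p * l : ℕ) : ℚ))⁻¹) ^ (p - 1 + s)) u) := by
    funext u; rfl
  rw [e, pTaylor_fun_mul ((h1.mul h2).mul h3) h4, pTaylor_fun_mul (h1.mul h2) h3, pTaylor_fun_mul h1 h2,
    pTaylor_const, pTaylor_fun_pow (by fun_prop : ContDiffAt ℚ (⊤ : ℕ∞) (fun u : ℚ => u + 0) (j : ℚ)),
    pTaylor_add_const, add_zero,
    pTaylor_fun_prod _ fun ν _ => contDiffAt_prod fun m _ => (by fun_prop :
      ContDiffAt ℚ (⊤ : ℕ∞) (fun u : ℚ => u + ((p * m + ν : ℕ) : ℚ)) (j : ℚ)),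
    pTaylor_fun_prod _ h4l]
  congr 1
  · congr 1
    refine prod_congr rfl fun ν _ => ?_
    rw [pTaylor_fun_prod _ fun m _ => (by fun_prop : ContDiffAt ℚ (⊤ : ℕ∞) (fun u : ℚ => u + ((p * m + ν : ℕ) : ℚ)) (j : ℚ))]
    refine prod_congr rfl fun m _ => ?_
    rw [pTaylor_add_const]
  · refine prod_congr rfl fun l _ => ?_
    rw [pTaylor_fun_pow (contDiffAt_inv_add (hne l)), pTaylor_inv_add_const p (hne l)]

/-- Degree bookkeeping: if `[X^a]F = 0` for `a > d₁` and `[X^a]G = 0` for `a > d₂` then `[X^a](FG) = 0` for `a > d₁+d₂`.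
[cite: LaiLupuSprang2025, Lemma 6.1 ("Noting that deg P = n")] -/
theorem coeff_mul_eq_zero_of_lt {F G : ℚ⟦X⟧} {d₁ d₂ : ℕ} (hF : ∀ a, d₁ < a → coeff a F = 0)
    (hG : ∀ a, d₂ < a → coeff a G = 0) (a : ℕ) (ha : d₁ + d₂ < a) : coeff a (F * G) = 0 := by
  rw [coeff_mul]
  refine sum_eq_zero fun ij hij => ?_
  have hsum : ij.1 + ij.2 = a := Finset.HasAntidiagonal.mem_antidiagonal.1 hij
  by_cases h : d₁ < ij.1
  · rw [hF _ h, zero_mul]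
  · rw [hG _ (by omega), mul_zero]

/-- A product of `n` monic linear factors `C c_m + X` has no coefficients beyond degree `n`.
[cite: LaiLupuSprang2025, Lemma 6.1 ("P(t) ∈ ℤ[t] … deg P = n")] -/
theorem coeff_prod_lin_eq_zero (c : ℕ → ℚ) (n : ℕ) :
    ∀ a, n < a → coeff a (∏ m ∈ range n, (C (c m) + X)) = 0 := by
  induction n with
  | zero => intro a ha; rw [prod_range_zero, coeff_one, if_neg (by omega)]
  | succ n ih =>
    intro a ha
    rw [prod_range_succ]
    refine coeff_mul_eq_zero_of_lt ih (d₂ := 1) (fun b hb => ?_) a (by omega)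
    rw [map_add, coeff_C, coeff_X, if_neg (by omega), if_neg (by omega), add_zero]

/-- The polynomial `P = ∏_{m<n}(C(m+1) + X)` of the line (6.2). [cite: LaiLupuSprang2025, Lemma 6.1 (6.2)] -/
def poleP (n : ℕ) : ℚ⟦X⟧ := ∏ m ∈ range n, (C ((m : ℚ) + 1) + X)

/-- `P` has `p`-integral coefficients («`P(t) ∈ ℤ[t]`»). [cite: LaiLupuSprang2025, Lemma 6.1 (6.2) ("P(t) ∈ ℤ[t]")] -/
theorem psOrdGe_poleP (p n : ℕ) [Fact p.Prime] : PSOrdGe p 0 (poleP n) :=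
  PSOrdGe.prod _ fun m _ => (PSOrdGe.C (by exact_mod_cast PadicOrdGe.of_nat (p := p) (m + 1))).add (PSOrdGe.X p)

/-- `deg P = n`: no coefficients beyond `X^n`. [cite: LaiLupuSprang2025, Lemma 6.1 ("Noting that deg P = n")] -/
theorem coeff_poleP_eq_zero (n : ℕ) : ∀ a, n < a → coeff a (poleP n) = 0 :=
  coeff_prod_lin_eq_zero (fun m => (m : ℚ) + 1) n

/-- The factor `Q ∈ ℤ_p⟦pX⟧` of (6.5): the lines (6.3)–(6.4) with `ν = p − j` removed from (6.3).
[cite: LaiLupuSprang2025, Lemma 6.1 (6.3)–(6.5)] -/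
def poleQ (p s n j : ℕ) : ℚ⟦X⟧ :=
  (C (j : ℚ) + C (p : ℚ) * X) ^ M0 p s *
    (∏ ν ∈ (Ico 1 p).erase (p - j), ∏ m ∈ range n, (C ((j : ℚ) + ((p * m + ν : ℕ) : ℚ)) + C (p : ℚ) * X)) *
      ∏ l ∈ range (n + 1), invLin (p : ℚ) ((j : ℚ) + ((p * l : ℕ) : ℚ)) ^ (p - 1 + s)

/-- The constant `p^{(p+1+s)(n+1)−M₀−2}·n!^s = p^{E'}·n!^s·p^n` of (6.5). [cite: LaiLupuSprang2025, Lemma 6.1 (6.5)] -/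
def poleConst (p s n : ℕ) : ℚ := (p : ℚ) ^ Eexp p s n * (n ! : ℚ) ^ s * (p : ℚ) ^ n

/-- `(j + pl)⁻¹` is `p`-integral for `p ∤ j`. [cite: LaiLupuSprang2025, Lemma 6.1 (6.4) ("belong to ℤ_p⟦pt⟧": j + pm is a unit)] -/
theorem padicOrdGe_inv_add_mul {p : ℕ} [Fact p.Prime] {j : ℕ} (hj : ¬ p ∣ j) (l : ℕ) :
    PadicOrdGe p 0 ((j : ℚ) + ((p * l : ℕ) : ℚ))⁻¹ := by
  have hnd : ¬ (p : ℤ) ∣ ((j + p * l : ℕ) : ℤ) := by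
    intro h
    have h' : (p : ℤ) ∣ (j : ℤ) := by
      have : ((j + p * l : ℕ) : ℤ) = (j : ℤ) + (p : ℤ) * l := by push_cast; ring
      rw [this] at h
      exact (dvd_add_left (dvd_mul_right _ _)).1 h
    exact hj (by exact_mod_cast h')
  have h := PadicOrdGe.inv_of_int (p := p) (c := ((j + p * l : ℕ) : ℤ)) (m := 0)
    (by rw [padicValInt.eq_zero_of_not_dvd hnd])
  simp only [Nat.cast_zero, neg_zero, Int.cast_natCast] at h
  push_cast at h ⊢
  exact h

/-- The exponent `(p+1+s)(n+1) − M₀ − 2` of Lemma 6.1, as `E' + n`. [cite: LaiLupuSprang2025, Lemma 6.1 (6.1)] -/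
def Epole (p s n : ℕ) : ℕ := Eexp p s n + n

/-- `Epole = (p+1+s)(n+1) − M₀ − 2` under the degree condition. [cite: LaiLupuSprang2025, Lemma 6.1 (6.1)] -/
theorem Epole_eq {p s n : ℕ} (hp : 1 ≤ p) (hM : M0 p s ≤ n + (n + 1) * (p - 1 + s)) :
    Epole p s n = (p + 1 + s) * (n + 1) - M0 p s - 2 := by
  unfold Epole Eexp
  obtain ⟨q, rfl⟩ : ∃ q, p = q + 1 := ⟨p - 1, by omega⟩
  rw [Nat.add_sub_cancel] at hM ⊢
  have : (q + 1 + 1 + s) * (n + 1) = n + (n + 1) * (q + s) + n + 2 := by ring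
  omega

/-- **(6.5): `Σ u_k X^k = p^{(p+1+s)(n+1)−M₀−2}·n!^s·P(X)·Q(X)`** — split `ν = p − j` off the product (6.3)
(`j + pm + (p−j) = p(m+1)`), which gives `p^n·P(X)`. [cite: LaiLupuSprang2025, Lemma 6.1 (6.5)] -/
theorem poleSer_eq_PQ {p : ℕ} (hp : 1 ≤ p) (s n : ℕ) (hM : M0 p s ≤ n + (n + 1) * (p - 1 + s)) {j : ℕ}
    (hj : j ∈ Ico 1 p) : poleSer p s n j = C (poleConst p s n) * poleP n * poleQ p s n j := by
  have hj1 : 1 ≤ j := (mem_Ico.1 hj).1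
  have hjp : j < p := (mem_Ico.1 hj).2
  have hν₀mem : p - j ∈ Ico 1 p := by rw [mem_Ico]; omega
  set G : ℕ → ℚ⟦X⟧ := fun ν => ∏ m ∈ range n, (C ((j : ℚ) + ((p * m + ν : ℕ) : ℚ)) + C (p : ℚ) * X) with hG
  have hsplit : ∏ ν ∈ Ico 1 p, G ν = G (p - j) * ∏ ν ∈ (Ico 1 p).erase (p - j), G ν := (mul_prod_erase _ _ hν₀mem).symm
  have hGν₀ : G (p - j) = C ((p : ℚ) ^ n) * poleP n := by
    simp only [hG, poleP]
    have hfac : ∀ m ∈ range n, (C ((j : ℚ) + ((p * m + (p - j) : ℕ) : ℚ)) + C (p : ℚ) * X) =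
        C (p : ℚ) * (C ((m : ℚ) + 1) + X) := by
      intro m _
      have e : (j : ℚ) + ((p * m + (p - j) : ℕ) : ℚ) = (p : ℚ) * ((m : ℚ) + 1) := by
        push_cast [Nat.cast_sub hjp.le]; ring
      rw [e, map_mul, mul_add]
    rw [prod_congr rfl hfac, prod_mul_distrib, prod_const, card_range, ← map_pow]
  rw [poleSer_eq_prod hp s n hM hj1]
  change C ((p : ℚ) ^ Eexp p s n * (n ! : ℚ) ^ s) * (C (j : ℚ) + C (p : ℚ) * X) ^ M0 p s * (∏ ν ∈ Ico 1 p, G ν) *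
      ∏ l ∈ range (n + 1), invLin (p : ℚ) ((j : ℚ) + ((p * l : ℕ) : ℚ)) ^ (p - 1 + s) = _
  rw [hsplit, hGν₀, poleConst, poleQ]
  simp only [map_mul, hG]
  ring

/-- **`Q ∈ ℤ_p⟦pX⟧`** («the factors in the lines (6.3) and (6.4) belong to `ℤ_p⟦pt⟧`»; `p ∤ j`).
[cite: LaiLupuSprang2025, Lemma 6.1 (6.3)–(6.5) ("Q(t) ∈ ℤ_p⟦pt⟧")] -/
theorem psOrdGeS_poleQ {p : ℕ} [hpr : Fact p.Prime] (s n : ℕ) {j : ℕ} (hj : j ∈ Ico 1 p) :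
    PSOrdGeS p 0 (poleQ p s n j) := by
  have hjd : ¬ p ∣ j := fun h => by
    have := Nat.le_of_dvd (by have := (mem_Ico.1 hj).1; omega) h
    have := (mem_Ico.1 hj).2; omega
  have hlin : PSOrdGeS p 0 (C (j : ℚ) + C (p : ℚ) * X) := psOrdGeS_lin (PadicOrdGe.of_nat (p := p) j)
  have hGs : PSOrdGeS p 0 (∏ ν ∈ (Ico 1 p).erase (p - j), ∏ m ∈ range n,
      (C ((j : ℚ) + ((p * m + ν : ℕ) : ℚ)) + C (p : ℚ) * X)) :=
    PSOrdGeS.prod _ fun ν _ => PSOrdGeS.prod _ fun m _ =>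
      psOrdGeS_lin (by exact_mod_cast PadicOrdGe.of_nat (p := p) (j + (p * m + ν)))
  have hinv : PSOrdGeS p 0 (∏ l ∈ range (n + 1), invLin (p : ℚ) ((j : ℚ) + ((p * l : ℕ) : ℚ)) ^ (p - 1 + s)) :=
    PSOrdGeS.prod _ fun l _ => (psOrdGeS_invLin (padicOrdGe_inv_add_mul hjd l)).pow _
  simpa [poleQ] using ((hlin.pow _).mul hGs).mul hinv

/-- `v_p(p^{E'} n!^s p^n) = Epole + s·v_p(n!)`. [cite: LaiLupuSprang2025, Lemma 6.1 (6.5)] -/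
theorem padicOrdGe_poleConst (p s n : ℕ) [Fact p.Prime] :
    PadicOrdGe p ((Epole p s n : ℤ) + s * padicValNat p (n !)) (poleConst p s n) := by
  have h1 : PadicOrdGe p (Eexp p s n : ℤ) ((p : ℚ) ^ Eexp p s n) := by
    simpa using (padicOrdGe_one_natCast p).pow (Eexp p s n)
  have h2 : PadicOrdGe p ((s : ℤ) * padicValNat p (n !)) ((n ! : ℚ) ^ s) := by
    have h0 : PadicOrdGe p (padicValNat p (n !) : ℤ) ((n ! : ℕ) : ℚ) :=
      PadicOrdGe.of_eq (by rw [padicValRat.of_nat])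
    simpa using h0.pow s
  have h3 : PadicOrdGe p (n : ℤ) ((p : ℚ) ^ n) := by simpa using (padicOrdGe_one_natCast p).pow n
  refine ((h1.mul h2).mul h3).mono (le_of_eq ?_)
  simp [Epole]; ring

/-- **Lemma 6.1, the coefficient bound: `v_p(u_a) ≥ (p+1+s)(n+1) − M₀ − 2 + s·v_p(n!) + max{0, a − n}`** (both
`+ (a − n)` and `+ 0`), from (6.5): `P` of degree `n` with integral coefficients, `Q ∈ ℤ_p⟦pX⟧`.
[cite: LaiLupuSprang2025, Lemma 6.1 ("v_p(u_k) ≥ (p+1+s)(n+1) + s·v_p(n!) − M_0 − 2 + max{0,k−n}")] -/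
theorem padicOrdGe_coeff_poleSer {p : ℕ} [hpr : Fact p.Prime] (s n : ℕ) (hM : M0 p s ≤ n + (n + 1) * (p - 1 + s))
    {j : ℕ} (hj : j ∈ Ico 1 p) (a : ℕ) :
    PadicOrdGe p ((Epole p s n : ℤ) + s * padicValNat p (n !) + ((a : ℤ) - n)) (coeff a (poleSer p s n j)) ∧
      PadicOrdGe p ((Epole p s n : ℤ) + s * padicValNat p (n !)) (coeff a (poleSer p s n j)) := by
  have hA : PSOrdGe p ((Epole p s n : ℤ) + s * padicValNat p (n !)) (C (poleConst p s n) * poleP n) := by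
    simpa using (PSOrdGe.C (padicOrdGe_poleConst p s n)).mul (psOrdGe_poleP p n)
  have hAdeg : ∀ b, n < b → coeff b (C (poleConst p s n) * poleP n) = 0 := fun b hb => by
    rw [coeff_C_mul, coeff_poleP_eq_zero n b hb, mul_zero]
  have hQ := psOrdGeS_poleQ s n hj
  rw [poleSer_eq_PQ hpr.out.one_lt.le s n hM hj]
  refine ⟨?_, ?_⟩
  · simpa using padicOrdGe_coeff_mul_of_degree_le hA hAdeg hQ a
  · simpa using (hA.mul hQ.psOrdGe) a

/-! ## §3. The primitive: `Σ_k (u_k/(k+1)) X^{k+1}` -/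

/-- The unit `j + pk` (numerator of `x_k = k + j/p = (j+pk)/p`). [cite: LaiLupuSprang2025, Lemma 6.1 (6.4)] -/
def wq (p j k : ℕ) : ℚ := (j : ℚ) + p * k

/-- `wq` unfolded. [cite: LaiLupuSprang2025, Lemma 6.1 (6.4)] -/
theorem wq_def (p j k : ℕ) : wq p j k = (j : ℚ) + p * k := rfl

/-- **The formal primitive of `Σ u_k X^k` through the partial fractions** (the series of `R̃_n(t + j/p) − R̃_n(j/p)`):
`Σ_k r_{1,k}·logSer p (j+pk) + Σ_k Σ_{i≥2} (r_{i,k}p^{i−1}/(1−i))·((invLin p (j+pk))^{i−1} − (j+pk)^{−(i−1)})`.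
[cite: LaiLupuSprang2025, §3 (3.3) and Lemma 6.1 ("𝓛_1(R_n(t+j/p)) = Σ_k u_k B_{k+1}/(k+1)")] -/
def polePrim (p s n j : ℕ) : ℚ⟦X⟧ :=
  ∑ k ∈ range (n + 1), (C (coeffR p s n 1 k) * logSer (p : ℚ) (wq p j k) +
    ∑ i ∈ Icc 2 (p - 1 + s), C (coeffR p s n i k * (p : ℚ) ^ (i - 1) / (1 - i)) *
      (invLin (p : ℚ) (wq p j k) ^ (i - 1) - C (((wq p j k) ^ (i - 1))⁻¹)))

/-- `d(C c · F) = C c · dF`. [cite: LaiLupuSprang2025, §3 (3.3)] -/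
theorem derivative_C_mul (c : ℚ) (F : ℚ⟦X⟧) : d⁄dX ℚ (C c * F) = C c * d⁄dX ℚ F := by
  rw [← smul_eq_C_mul, ← smul_eq_C_mul, (d⁄dX ℚ).map_smul]

/-- **`(polePrim)′ = Σ u_k X^k`**: termwise `(r_{1,k} logSer)′ = r_{1,k}p·invLin` and
`((r_{i,k}p^{i−1}/(1−i))(invLin)^{i−1})′ = r_{i,k}p^i (invLin)^i`, which is the partial-fraction form of `poleSer`
(«the derivative of `R̃_n` coincides with `R_n`»). [cite: LaiLupuSprang2025, §3 (3.3) and Lemma 6.1] -/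
theorem derivative_polePrim {p : ℕ} (hp : p.Prime) (s n : ℕ) (hs : 1 ≤ s)
    (hdeg : M0 p s + (p - 1) * n < (p - 1 + s) * (n + 1)) {j : ℕ} (hj : j ∈ Ico 1 p) :
    d⁄dX ℚ (polePrim p s n j) = poleSer p s n j := by
  have hp2 : 2 ≤ p := hp.two_le
  rw [poleSer_eq_sum hp s n hdeg hj, polePrim, map_sum]
  refine sum_congr rfl fun k _ => ?_
  have hIcc : Icc 1 (p - 1 + s) = insert 1 (Icc 2 (p - 1 + s)) :=
    (Finset.insert_Icc_add_one_left_eq_Icc (by omega : 1 ≤ p - 1 + s)).symm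
  have h1 : (1 : ℕ) ∉ Icc 2 (p - 1 + s) := by simp
  rw [hIcc, sum_insert h1, map_add, map_sum, derivative_C_mul, derivative_logSer, pow_one, pow_one, ← mul_assoc,
    ← map_mul, wq_def]
  congr 1
  refine sum_congr rfl fun i hi => ?_
  have hi2 : 2 ≤ i := (mem_Icc.1 hi).1
  obtain ⟨a, rfl⟩ : ∃ a, i = a + 2 := ⟨i - 2, by omega⟩
  rw [derivative_C_mul, map_sub, derivative_C, sub_zero, show a + 2 - 1 = a + 1 by omega, derivative_invLin_pow,
    ← mul_assoc, mul_neg, ← map_mul, ← map_neg]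
  congr 2
  have hi1 : (1 : ℚ) - ((a + 2 : ℕ) : ℚ) ≠ 0 := by push_cast; linarith [(Nat.cast_nonneg a : (0 : ℚ) ≤ a)]
  field_simp
  push_cast
  ring

/-- `polePrim` has no constant term (`R̃_n(t+j/p) − R̃_n(j/p)` vanishes at `t = 0`).
[cite: LaiLupuSprang2025, Lemma 2.4 (f(0) subtracted) and §3 (3.3)] -/
theorem coeff_zero_polePrim (p s n j : ℕ) : coeff 0 (polePrim p s n j) = 0 := by
  rw [polePrim, map_sum]
  refine sum_eq_zero fun k _ => ?_
  rw [map_add, coeff_C_mul, coeff_logSer_zero, mul_zero, zero_add, map_sum]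
  refine sum_eq_zero fun i hi => ?_
  have hi2 : 2 ≤ i := (mem_Icc.1 hi).1
  obtain ⟨a, rfl⟩ : ∃ a, i = a + 2 := ⟨i - 2, by omega⟩
  rw [coeff_C_mul, map_sub, show a + 2 - 1 = a + 1 by omega, coeff_invLin_pow, coeff_C, if_pos rfl]
  simp

/-- **`[X^{m+1}] polePrim = u_m/(m+1)`** (the coefficients `u_k/(k+1)` of the primitive).
[cite: LaiLupuSprang2025, Lemma 6.1 ("Σ_k u_k B_{k+1}/(k+1)")] -/
theorem coeff_succ_polePrim {p : ℕ} (hp : p.Prime) (s n : ℕ) (hs : 1 ≤ s)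
    (hdeg : M0 p s + (p - 1) * n < (p - 1 + s) * (n + 1)) {j : ℕ} (hj : j ∈ Ico 1 p) (m : ℕ) :
    coeff (m + 1) (polePrim p s n j) = coeff m (poleSer p s n j) / ((m : ℚ) + 1) := by
  have h := coeff_derivative (polePrim p s n j) m
  rw [derivative_polePrim hp s n hs hdeg hj] at h
  have hm : ((m : ℚ) + 1) ≠ 0 := by positivity
  rw [eq_div_iff hm, h]

/-! ## §4. The analytic bridge: `R̃_n(t + j/p) − R̃_n(j/p) = Σ_k (u_k/(k+1)) t^{k+1}` on `ℤ_p` -/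

section Analytic

variable {p : ℕ} [hpr : Fact p.Prime]

/-- `‖j + pk‖_p = 1` (`p ∤ j`). [cite: LaiLupuSprang2025, Lemma 6.1 (6.4) (the units pm + j)] -/
theorem norm_wq_eq_one {j : ℕ} (hj : ¬ p ∣ j) (k : ℕ) : ‖((wq p j k : ℚ) : ℚ_[p])‖ = 1 := by
  have hnd : ¬ (p : ℤ) ∣ ((j + p * k : ℕ) : ℤ) := by
    intro hd
    apply hj
    have : (p : ℤ) ∣ (j : ℤ) := by
      have e : ((j + p * k : ℕ) : ℤ) = (j : ℤ) + (p : ℤ) * k := by push_cast; ring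
      rw [e] at hd
      exact (dvd_add_left (dvd_mul_right _ _)).1 hd
    exact_mod_cast this
  -- an integer prime to `p` is a `p`-adic unit
  have h : ‖((((j + p * k : ℕ) : ℤ)) : ℚ_[p])‖ = 1 :=
    le_antisymm (Padic.norm_int_le_one _) (not_lt.mp fun h => hnd (Padic.norm_intCast_lt_one_iff.mp h))
  rw [wq]
  push_cast at h ⊢
  exact h

/-- `j + pk ≠ 0` in `ℚ_p`. [cite: LaiLupuSprang2025, Lemma 6.1 (6.4)] -/
theorem wq_cast_ne_zero {j : ℕ} (hj : ¬ p ∣ j) (k : ℕ) : ((wq p j k : ℚ) : ℚ_[p]) ≠ 0 := by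
  rw [← norm_pos_iff, norm_wq_eq_one hj k]; exact one_pos

/-- `‖p·t/(j+pk)‖_p < 1` for `t ∈ ℤ_p`. [cite: LaiLupuSprang2025, Lemma 6.1 ("R_n(t+j/p) ∈ C^{an}(ℤ_p,ℚ_p)")] -/
theorem norm_p_mul_div_wq_lt_one {j : ℕ} (hj : ¬ p ∣ j) (k : ℕ) (t : ℤ_[p]) :
    ‖((p : ℚ) : ℚ_[p]) * (t : ℚ_[p]) / ((wq p j k : ℚ) : ℚ_[p])‖ < 1 := by
  rw [norm_div, norm_wq_eq_one hj k, div_one, norm_mul, Rat.cast_natCast]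
  calc ‖(p : ℚ_[p])‖ * ‖(t : ℚ_[p])‖ ≤ ‖(p : ℚ_[p])‖ * 1 := by
        gcongr; exact PadicInt.norm_le_one t
    _ < 1 := by rw [mul_one]; exact Padic.norm_p_lt_one

/-- **The logarithmic pieces**: `log_p⟨t+k+j/p⟩ − log_p⟨k+j/p⟩ = log_p(1 + pt/(j+pk)) = Σ_m t^m [X^m]logSer p (j+pk)` on
`ℤ_p` (functional equation of `log_p` on `1 + pℤ_p`, then the logarithmic series).
[cite: LaiLupuSprang2025, §3 (3.3) and Lemma 4.3 (4.5)–(4.6)] -/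
theorem hasSum_Lx_sub {j : ℕ} (hj : j ∈ Ico 1 p) (k : ℕ) (t : ℤ_[p]) :
    HasSum (fun m : ℕ => (t : ℚ_[p]) ^ m * ((coeff m (logSer (p : ℚ) (wq p j k)) : ℚ) : ℚ_[p]))
      (Lx (xj p j) (t + k) - Lx (xj p j) ((0 : ℤ_[p]) + k)) := by
  have hj1 : 1 ≤ j := (mem_Ico.1 hj).1
  have hjp : j < p := (mem_Ico.1 hj).2
  have hjd : ¬ p ∣ j := fun h => by have := Nat.le_of_dvd (by omega) h; omega
  have hp0 : (p : ℚ_[p]) ≠ 0 := by exact_mod_cast hpr.out.ne_zero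
  have hj0 : (j : ℚ_[p]) ≠ 0 := by exact_mod_cast (show j ≠ 0 by omega)
  have hw0 := wq_cast_ne_zero hjd k
  have hwq : wq p j k ≠ 0 := by rw [wq]; positivity
  -- the two principal units
  have hy1 : ‖(1 : ℚ_[p]) - (1 + (p : ℚ_[p]) * k / j)‖ < 1 := by
    rw [show (1 : ℚ_[p]) - (1 + (p : ℚ_[p]) * k / j) = -((p : ℚ_[p]) * k / j) by ring, norm_neg, norm_div,
      norm_mul]
    have hjn : ‖(j : ℚ_[p])‖ = 1 := by simpa [wq] using norm_wq_eq_one hjd 0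
    rw [hjn, div_one]
    calc ‖(p : ℚ_[p])‖ * ‖(k : ℚ_[p])‖ ≤ ‖(p : ℚ_[p])‖ * 1 := by
          gcongr; simpa using Padic.norm_int_le_one (p := p) (k : ℤ)
      _ < 1 := by rw [mul_one]; exact Padic.norm_p_lt_one
  have hz := norm_p_mul_div_wq_lt_one hjd k t
  have hy2 : ‖(1 : ℚ_[p]) - (1 + ((p : ℚ) : ℚ_[p]) * (t : ℚ_[p]) / ((wq p j k : ℚ) : ℚ_[p]))‖ < 1 := by
    rw [show (1 : ℚ_[p]) - (1 + ((p : ℚ) : ℚ_[p]) * (t : ℚ_[p]) / ((wq p j k : ℚ) : ℚ_[p])) = -(((p : ℚ) : ℚ_[p]) * (t : ℚ_[p]) / ((wq p j k : ℚ) : ℚ_[p])) by ring, norm_neg]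
    exact hz
  have h := hasSum_logSer (p := p) (q := (p : ℚ)) hwq hz
  -- identify the value: `Lx x (t+k) − Lx x k = log_p((1 + pk/j)(1 + pt/(j+pk))) − log_p(1 + pk/j)`
  have key : ∀ J P K T : ℚ_[p], J ≠ 0 → P ≠ 0 → J + P * K ≠ 0 →
      1 + (T + K) / (J / P) = (1 + P * K / J) * (1 + P * T / (J + P * K)) := by
    intro J P K T hJ hP hJK
    rw [div_div_eq_mul_div, one_add_div hJ, one_add_div hJK, one_add_div hJ,
      div_mul_div_comm, div_eq_div_iff hJ (mul_ne_zero hJ hJK)]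
    ring
  have e1 : (((t + k : ℤ_[p]) : ℚ_[p])) = (t : ℚ_[p]) + k := by
    simp only [PadicInt.coe_add, PadicInt.coe_natCast]
  have e2 : ((wq p j k : ℚ) : ℚ_[p]) = (j : ℚ_[p]) + p * k := by rw [wq]; push_cast; ring
  have e3 : ((p : ℚ) : ℚ_[p]) = (p : ℚ_[p]) := by push_cast; ring
  have hw0' : (j : ℚ_[p]) + p * k ≠ 0 := e2 ▸ hw0
  have hprod : (1 + (((t + k : ℤ_[p]) : ℚ_[p])) / xj p j) =
      (1 + (p : ℚ_[p]) * k / j) * (1 + ((p : ℚ) : ℚ_[p]) * (t : ℚ_[p]) / ((wq p j k : ℚ) : ℚ_[p])) := by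
    rw [e1, e2, e3, xj]
    exact key _ _ _ _ hj0 hp0 hw0'
  have hval : Lx (xj p j) (t + k) - Lx (xj p j) ((0 : ℤ_[p]) + k) =
      Transcendental.PadicExp.plog (1 + ((p : ℚ) : ℚ_[p]) * (t : ℚ_[p]) / ((wq p j k : ℚ) : ℚ_[p])) := by
    simp only [Lx]
    rw [hprod, Transcendental.PadicExp.plog_mul (ℓ := p) hy1 hy2]
    have e0 : (1 + ((((0 : ℤ_[p]) + k : ℤ_[p]) : ℚ_[p])) / xj p j) = 1 + (p : ℚ_[p]) * k / j := by
      simp only [xj, zero_add, PadicInt.coe_natCast]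
      rw [div_div_eq_mul_div, mul_comm]
    rw [e0]
    ring
  rw [hval]
  exact h

/-- `t + k + j/p = ((j+pk) + pt)/p` in `ℚ_p`. [cite: LaiLupuSprang2025, §3 (3.3)] -/
theorem xj_add_eq (j k : ℕ) (t : ℤ_[p]) : xj p j + k + (t : ℚ_[p]) = (((wq p j k : ℚ) : ℚ_[p]) + ((p : ℚ) : ℚ_[p]) * (t : ℚ_[p])) / p := by
  have hp0 : (p : ℚ_[p]) ≠ 0 := by exact_mod_cast hpr.out.ne_zero
  simp only [xj, wq]
  push_cast
  field_simp

/-- `y^{1−i} = (y^{i−1})^{−1}` for `i = a + 2 ≥ 2`. [cite: LaiLupuSprang2025, §3 (3.3)] -/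
theorem zpow_one_sub_eq (y : ℚ_[p]) (a : ℕ) : y ^ (1 - ((a + 2 : ℕ) : ℤ)) = (y ^ (a + 1))⁻¹ := by
  rw [show (1 : ℤ) - ((a + 2 : ℕ) : ℤ) = -((a + 1 : ℕ) : ℤ) by push_cast; ring, zpow_neg, zpow_natCast]

/-- **The power pieces**: `(t+k+j/p)^{1−i} = p^{i−1}·((j+pk) + pt)^{−(i−1)}`. [cite: LaiLupuSprang2025, §3 (3.3)] -/
theorem xj_add_zpow (j k a : ℕ) (t : ℤ_[p]) :
    (xj p j + k + (t : ℚ_[p])) ^ (1 - ((a + 2 : ℕ) : ℤ)) = (p : ℚ_[p]) ^ (a + 1) * ((((wq p j k : ℚ) : ℚ_[p]) + ((p : ℚ) : ℚ_[p]) * (t : ℚ_[p])) ^ (a + 1))⁻¹ := by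
  rw [xj_add_eq, zpow_one_sub_eq, div_pow, inv_div, div_eq_mul_inv]

/-- **The power pieces as binomial series**: `((j+pk)+pt)^{−(a+1)} − (j+pk)^{−(a+1)} = Σ_{m≥1} t^m [X^m](invLin p (j+pk))^{a+1}`
on `ℤ_p`. [cite: LaiLupuSprang2025, §3 (3.3) and Lemma 6.1] -/
theorem hasSum_invLin_pow_sub {j : ℕ} (hj : j ∈ Ico 1 p) (k a : ℕ) (t : ℤ_[p]) :
    HasSum (fun m : ℕ => (t : ℚ_[p]) ^ m * ((coeff m (invLin (p : ℚ) (wq p j k) ^ (a + 1) -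
        C (((wq p j k) ^ (a + 1))⁻¹)) : ℚ) : ℚ_[p]))
      (((((wq p j k : ℚ) : ℚ_[p]) + ((p : ℚ) : ℚ_[p]) * (t : ℚ_[p])) ^ (a + 1))⁻¹ - (((wq p j k : ℚ) : ℚ_[p]) ^ (a + 1))⁻¹) := by
  have hj1 : 1 ≤ j := (mem_Ico.1 hj).1
  have hjp : j < p := (mem_Ico.1 hj).2
  have hjd : ¬ p ∣ j := fun h => by have := Nat.le_of_dvd (by omega) h; omega
  have hwq : wq p j k ≠ 0 := by rw [wq]; positivity
  have h := hasSum_invLin_pow (p := p) (q := (p : ℚ)) hwq (norm_p_mul_div_wq_lt_one hjd k t) a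
  have h0 := hasSum_ite_eq (0 : ℕ) (((((wq p j k) ^ (a + 1))⁻¹ : ℚ) : ℚ_[p]))
  have e : (fun m : ℕ => (t : ℚ_[p]) ^ m * ((coeff m (invLin (p : ℚ) (wq p j k) ^ (a + 1) -
      C (((wq p j k) ^ (a + 1))⁻¹)) : ℚ) : ℚ_[p])) = fun m : ℕ =>
      (t : ℚ_[p]) ^ m * ((coeff m (invLin (p : ℚ) (wq p j k) ^ (a + 1)) : ℚ) : ℚ_[p]) -
        (if m = 0 then (((((wq p j k) ^ (a + 1))⁻¹ : ℚ) : ℚ_[p])) else 0) := by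
    funext m
    rw [map_sub, coeff_C, Rat.cast_sub, mul_sub]
    rcases m with _ | m
    · simp
    · simp
  have e' : (((wq p j k : ℚ) : ℚ_[p]) ^ (a + 1))⁻¹ = (((((wq p j k) ^ (a + 1))⁻¹ : ℚ) : ℚ_[p])) := by push_cast; rfl
  rw [e, e']
  exact h.sub h0

/-- `R̃_n(t+j/p) − R̃_n(j/p)`, term by term. [cite: LaiLupuSprang2025, §3 (3.3) and Lemma 4.3 (4.4)] -/
theorem Rtil_sub_Rtil_zero (s n j : ℕ) (t : ℤ_[p]) :
    Rtil p s n j t - Rtil p s n j 0 = ∑ k ∈ range (n + 1),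
      ((((coeffR p s n 1 k : ℚ) : ℚ_[p]) * (Lx (xj p j) (t + k) - Lx (xj p j) ((0 : ℤ_[p]) + k)) +
        ∑ i ∈ Icc 2 (p - 1 + s), ((coeffR p s n i k / (1 - i) : ℚ) : ℚ_[p]) *
          ((xj p j + k + (t : ℚ_[p])) ^ (1 - (i : ℤ)) - (xj p j + k + ((0 : ℤ_[p]) : ℚ_[p])) ^ (1 - (i : ℤ))))) := by
  simp only [Rtil, ← sum_sub_distrib, mul_sub, add_sub_add_comm]

/-- The pieces of the expansion (term function). [cite: LaiLupuSprang2025, §3 (3.3)] -/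
def poleTerm (p : ℕ) [Fact p.Prime] (s n j : ℕ) (t : ℤ_[p]) (m : ℕ) : ℚ_[p] :=
  ∑ k ∈ range (n + 1),
    ((((coeffR p s n 1 k : ℚ) : ℚ_[p]) * ((t : ℚ_[p]) ^ m * ((coeff m (logSer (p : ℚ) (wq p j k)) : ℚ) : ℚ_[p])) +
      ∑ i ∈ Icc 2 (p - 1 + s), (((coeffR p s n i k / (1 - i) : ℚ) : ℚ_[p]) * (p : ℚ_[p]) ^ (i - 1)) *
        ((t : ℚ_[p]) ^ m * ((coeff m (invLin (p : ℚ) (wq p j k) ^ (i - 1) - C (((wq p j k) ^ (i - 1))⁻¹)) : ℚ) : ℚ_[p]))))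

/-- The pieces of the expansion (value). [cite: LaiLupuSprang2025, §3 (3.3)] -/
def poleVal (p : ℕ) [Fact p.Prime] (s n j : ℕ) (t : ℤ_[p]) : ℚ_[p] :=
  ∑ k ∈ range (n + 1),
    ((((coeffR p s n 1 k : ℚ) : ℚ_[p]) * (Lx (xj p j) (t + k) - Lx (xj p j) ((0 : ℤ_[p]) + k)) +
      ∑ i ∈ Icc 2 (p - 1 + s), (((coeffR p s n i k / (1 - i) : ℚ) : ℚ_[p]) * (p : ℚ_[p]) ^ (i - 1)) *
        (((((wq p j k : ℚ) : ℚ_[p]) + ((p : ℚ) : ℚ_[p]) * (t : ℚ_[p])) ^ (i - 1))⁻¹ - (((wq p j k : ℚ) : ℚ_[p]) ^ (i - 1))⁻¹)))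

/-- The pieces sum. [cite: LaiLupuSprang2025, §3 (3.3) and Lemma 6.1] -/
theorem hasSum_poleTerm {j : ℕ} (hj : j ∈ Ico 1 p) (s n : ℕ) (t : ℤ_[p]) :
    HasSum (poleTerm p s n j t) (poleVal p s n j t) := by
  unfold poleTerm poleVal
  refine hasSum_sum fun k _ => ((hasSum_Lx_sub hj k t).mul_left _).add (hasSum_sum fun i hi => ?_)
  have hi2 : 2 ≤ i := (mem_Icc.1 hi).1
  obtain ⟨a, rfl⟩ : ∃ a, i = a + 2 := ⟨i - 2, by omega⟩
  simp only [show a + 2 - 1 = a + 1 by omega]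
  exact (hasSum_invLin_pow_sub hj k a t).mul_left _

/-- The value is `R̃_n(t+j/p) − R̃_n(j/p)`. [cite: LaiLupuSprang2025, §3 (3.3)] -/
theorem poleVal_eq (s n j : ℕ) (t : ℤ_[p]) : poleVal p s n j t = Rtil p s n j t - Rtil p s n j 0 := by
  rw [Rtil_sub_Rtil_zero, poleVal]
  refine sum_congr rfl fun k _ => ?_
  congr 1
  refine sum_congr rfl fun i hi => ?_
  have hi2 : 2 ≤ i := (mem_Icc.1 hi).1
  obtain ⟨a, rfl⟩ : ∃ a, i = a + 2 := ⟨i - 2, by omega⟩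
  rw [xj_add_zpow, xj_add_zpow, show a + 2 - 1 = a + 1 by omega]
  simp only [PadicInt.coe_zero, mul_zero, add_zero]
  ring

/-- The terms are `t^m · [X^m] polePrim`. [cite: LaiLupuSprang2025, §3 (3.3)] -/
theorem poleTerm_eq (s n j : ℕ) (t : ℤ_[p]) (m : ℕ) :
    poleTerm p s n j t m = (t : ℚ_[p]) ^ m * ((coeff m (polePrim p s n j) : ℚ) : ℚ_[p]) := by
  rw [poleTerm, polePrim, map_sum, Rat.cast_sum, mul_sum]
  refine sum_congr rfl fun k _ => ?_
  rw [map_add, coeff_C_mul, map_sum, Rat.cast_add, Rat.cast_mul, Rat.cast_sum, mul_add, mul_sum]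
  congr 1
  · ring
  · refine sum_congr rfl fun i _ => ?_
    rw [coeff_C_mul, Rat.cast_mul]
    push_cast
    ring

/-- **The analytic bridge: `R̃_n(t + j/p) − R̃_n(j/p) = Σ_m ([X^m] polePrim)·t^m` on `ℤ_p`** — the logarithms through
`log_p⟨t+k+j/p⟩ − log_p⟨k+j/p⟩ = log_p(1 + pt/(j+pk))` and the powers through the binomial series, i.e. the Taylor
expansion `R̃_n(t+j/p) − R̃_n(j/p) = Σ_k (u_k/(k+1)) t^{k+1}` whose derivative is `R_n(t+j/p) = Σ u_k t^k`.
[cite: LaiLupuSprang2025, §3 (3.3), Lemma 2.4 and Lemma 6.1] -/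
theorem hasSum_polePrim {j : ℕ} (hj : j ∈ Ico 1 p) (s n : ℕ) (t : ℤ_[p]) :
    HasSum (fun m : ℕ => (t : ℚ_[p]) ^ m * ((coeff m (polePrim p s n j) : ℚ) : ℚ_[p]))
      (Rtil p s n j t - Rtil p s n j 0) := by
  have h := hasSum_poleTerm hj s n t
  rw [poleVal_eq, show poleTerm p s n j t = fun m => (t : ℚ_[p]) ^ m * ((coeff m (polePrim p s n j) : ℚ) : ℚ_[p])
    from funext (poleTerm_eq s n j t)] at h
  exact h

/-! ## §5. Lemma 6.1: `S_{j/p} + R̃_n(j/p) = −Σ_k B_{k+1}u_k/(k+1)` and its size -/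

/-- The coefficients `a_m := [X^m] polePrim ∈ ℚ ⊂ ℚ_p` (`a_0 = 0`, `a_{k+1} = u_k/(k+1)`).
[cite: LaiLupuSprang2025, Lemma 6.1 ("Σ_k u_k B_{k+1}/(k+1)")] -/
def poleCoeff (p : ℕ) [Fact p.Prime] (s n j m : ℕ) : ℚ_[p] := ((coeff m (polePrim p s n j) : ℚ) : ℚ_[p])

/-- `a_m → 0` (the expansion converges at `t = 1 ∈ ℤ_p`). [cite: LaiLupuSprang2025, Lemma 6.1 ("R_n(t+j/p) ∈ C^{an}(ℤ_p,ℚ_p)")] -/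
theorem tendsto_poleCoeff {j : ℕ} (hj : j ∈ Ico 1 p) (s n : ℕ) : Tendsto (poleCoeff p s n j) atTop (𝓝 0) := by
  have h := (hasSum_polePrim hj s n 1).summable.tendsto_atTop_zero
  have e : poleCoeff p s n j = fun m : ℕ => ((1 : ℤ_[p]) : ℚ_[p]) ^ m * ((coeff m (polePrim p s n j) : ℚ) : ℚ_[p]) := by
    funext m; simp [poleCoeff]
  rw [e]; exact h

/-- `R̃_n(t+j/p) = R̃_n(j/p) + Σ_m a_m t^m` on `ℤ_p`. [cite: LaiLupuSprang2025, Lemma 6.1 and §3 (3.3)] -/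
theorem Rtil_eq_tsum {j : ℕ} (hj : j ∈ Ico 1 p) (s n : ℕ) (t : ℤ_[p]) :
    Rtil p s n j t = Rtil p s n j 0 + ∑' m : ℕ, ((t : ℚ_[p]) ^ m) • poleCoeff p s n j m := by
  have h := (hasSum_polePrim hj s n t).tsum_eq
  simp only [poleCoeff, smul_eq_mul]
  rw [h]
  ring

/-- **Lemma 2.4 applied to `f = R̃_n(t+j/p)` (`S_{j/p} = −𝓛_1(R_n(t+j/p)) − R̃_n(j/p)`), with `𝓛_1` evaluated by
term-by-term Volkenborn integration: `S_{j/p} + R̃_n(j/p) = −Σ_m B_m a_m = −Σ_k B_{k+1} u_k/(k+1)`.**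
[cite: LaiLupuSprang2025, Lemma 2.4, Lemma 6.1 and proof of Lemma 6.3 (first display)] -/
theorem Sj_add_Rtil_zero_eq {j : ℕ} (hj : j ∈ Ico 1 p) (s n : ℕ) :
    Sj p s n j + Rtil p s n j 0 = -∑' m : ℕ, (((bernoulli m : ℚ) : ℚ_[p])) • poleCoeff p s n j m := by
  have hI : volkenbornIntegral p (Rtil p s n j) =
      Rtil p s n j 0 + ∑' m : ℕ, (((bernoulli m : ℚ) : ℚ_[p])) • poleCoeff p s n j m := by
    apply volkenbornIntegral_eq
    have h1 := tendsto_volkenbornSum_powerSeries (p := p) (tendsto_poleCoeff hj s n)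
    have e : Rtil p s n j = fun t : ℤ_[p] => Rtil p s n j 0 + ∑' m : ℕ, ((t : ℚ_[p]) ^ m) • poleCoeff p s n j m :=
      funext (Rtil_eq_tsum hj s n)
    have e2 : volkenbornSum p (Rtil p s n j) =
        fun N => Rtil p s n j 0 + volkenbornSum p (fun t : ℤ_[p] => ∑' m : ℕ, ((t : ℚ_[p]) ^ m) • poleCoeff p s n j m) N := by
      funext N
      conv_lhs => rw [e]
      rw [volkenbornSum_add, volkenbornSum_const]
    rw [e2]
    exact tendsto_const_nhds.add h1
  rw [Sj, hI]
  ring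

/-- `v_p(u_a) ≥ Epole + s·v_p(n!) + max{0, a−n}` with `ℕ`-truncated `a − n`. [cite: LaiLupuSprang2025, Lemma 6.1 ("+ max{0,k−n}")] -/
theorem padicOrdGe_coeff_poleSer_max (s n : ℕ) (hM : M0 p s ≤ n + (n + 1) * (p - 1 + s)) {j : ℕ} (hj : j ∈ Ico 1 p)
    (a : ℕ) : PadicOrdGe p ((Epole p s n : ℤ) + s * padicValNat p (n !) + ((a - n : ℕ) : ℤ)) (coeff a (poleSer p s n j)) := by
  by_cases h : n ≤ a
  · have := (padicOrdGe_coeff_poleSer s n hM hj a).1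
    rwa [Nat.cast_sub h]
  · have := (padicOrdGe_coeff_poleSer s n hM hj a).2
    rwa [Nat.sub_eq_zero_of_le (by omega), Nat.cast_zero, add_zero]

/-- **The size of the coefficients `a_{k+1} = u_k/(k+1)`**: `‖a_m‖_p ≤ (n+1)·p^{−(Epole + s·v_p(n!))}` — the loss
`v_p(k+1)` is absorbed by the gain `max{0,k−n}` up to `log_p(n+1)`.
[cite: LaiLupuSprang2025, Lemma 6.1 (last display: "≥ … − M_0 − 3 − ⌊log(n+1)/log p⌋")] -/
theorem norm_poleCoeff_le (s n : ℕ) (hs : 1 ≤ s) (hdeg : M0 p s + (p - 1) * n < (p - 1 + s) * (n + 1))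
    (hM : M0 p s ≤ n + (n + 1) * (p - 1 + s)) {j : ℕ} (hj : j ∈ Ico 1 p) (m : ℕ) :
    ‖poleCoeff p s n j m‖ ≤ ((n : ℝ) + 1) * (p : ℝ) ^ (-((Epole p s n : ℤ) + s * padicValNat p (n !))) := by
  have hp1 : (1 : ℝ) ≤ p := by exact_mod_cast hpr.out.one_lt.le
  have hp0 : (0 : ℝ) < p := by positivity
  rcases m with _ | m
  · rw [poleCoeff, coeff_zero_polePrim, Rat.cast_zero, norm_zero]; positivity
  rw [poleCoeff, coeff_succ_polePrim hpr.out s n hs hdeg hj m, Rat.cast_div, norm_div]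
  -- the numerator
  have hnum : ‖((coeff m (poleSer p s n j) : ℚ) : ℚ_[p])‖ ≤
      (p : ℝ) ^ (-((Epole p s n : ℤ) + s * padicValNat p (n !) + ((m - n : ℕ) : ℤ))) :=
    norm_ratCast_le_of_padicOrdGe (padicOrdGe_coeff_poleSer_max s n hM hj m)
  -- the denominator `‖m+1‖_p = p^{-v_p(m+1)}` and `p^{v_p(m+1)} ≤ (n+1) p^{m-n}`
  have hden : ‖(((m : ℚ) + 1 : ℚ) : ℚ_[p])‖ = (p : ℝ) ^ (-(padicValNat p (m + 1) : ℤ)) := by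
    rw [show ((m : ℚ) + 1 : ℚ) = ((m + 1 : ℕ) : ℚ) by push_cast; ring, Padic.eq_padicNorm,
      padicNorm.eq_zpow_of_nonzero (by positivity), padicValRat.of_nat]
    push_cast
    rfl
  have hden_pos : 0 < ‖(((m : ℚ) + 1 : ℚ) : ℚ_[p])‖ := by rw [hden]; positivity
  have hv : (p : ℝ) ^ (padicValNat p (m + 1) : ℤ) ≤ ((n : ℝ) + 1) * (p : ℝ) ^ ((m - n : ℕ) : ℤ) := by
    rw [zpow_natCast, zpow_natCast]
    have := pow_padicValNat_le_mul_pow (p := p) (Nat.succ_ne_zero m) n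
    rw [show m + 1 - 1 - n = m - n by omega] at this
    exact_mod_cast this
  rw [div_le_iff₀ hden_pos, hden]
  calc ‖((coeff m (poleSer p s n j) : ℚ) : ℚ_[p])‖
      ≤ (p : ℝ) ^ (-((Epole p s n : ℤ) + s * padicValNat p (n !) + ((m - n : ℕ) : ℤ))) := hnum
    _ = (p : ℝ) ^ (-((Epole p s n : ℤ) + s * padicValNat p (n !))) * ((p : ℝ) ^ ((m - n : ℕ) : ℤ))⁻¹ *
          ((p : ℝ) ^ (padicValNat p (m + 1) : ℤ) * (p : ℝ) ^ (-(padicValNat p (m + 1) : ℤ))) := by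
        rw [zpow_neg _ (padicValNat p (m + 1) : ℤ), mul_inv_cancel₀ (by positivity), mul_one, ← zpow_neg, ← zpow_add₀ hp0.ne']
        congr 1; ring
    _ ≤ (p : ℝ) ^ (-((Epole p s n : ℤ) + s * padicValNat p (n !))) * ((p : ℝ) ^ ((m - n : ℕ) : ℤ))⁻¹ *
          ((((n : ℝ) + 1) * (p : ℝ) ^ ((m - n : ℕ) : ℤ)) * (p : ℝ) ^ (-(padicValNat p (m + 1) : ℤ))) := by
        gcongr
    _ = ((n : ℝ) + 1) * (p : ℝ) ^ (-((Epole p s n : ℤ) + s * padicValNat p (n !))) *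
          (p : ℝ) ^ (-(padicValNat p (m + 1) : ℤ)) := by
        have : ((p : ℝ) ^ ((m - n : ℕ) : ℤ)) ≠ 0 := by positivity
        field_simp

/-- **Lemma 6.1 (with Lemma 2.4): `‖S_{j/p} + R̃_n(j/p)‖_p ≤ p·(n+1)·p^{−((p+1+s)(n+1) − M₀ − 2 + s·v_p(n!))}`**, i.e.
`v_p(𝓛_1(R_n(t+j/p))) ≥ (p+1+s)(n+1) + s·v_p(n!) − M₀ − 3 − log_p(n+1)` (von Staudt–Clausen `‖B_m‖_p ≤ p`).
[cite: LaiLupuSprang2025, Lemma 6.1] -/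
theorem norm_Sj_add_Rtil_zero_le (s n : ℕ) (hs : 1 ≤ s) (hdeg : M0 p s + (p - 1) * n < (p - 1 + s) * (n + 1))
    (hM : M0 p s ≤ n + (n + 1) * (p - 1 + s)) {j : ℕ} (hj : j ∈ Ico 1 p) :
    ‖Sj p s n j + Rtil p s n j 0‖ ≤ p * (((n : ℝ) + 1) * (p : ℝ) ^ (-((Epole p s n : ℤ) + s * padicValNat p (n !)))) := by
  rw [Sj_add_Rtil_zero_eq hj s n, norm_neg]
  exact norm_tsum_bernoulli_smul_le (by positivity) (norm_poleCoeff_le s n hs hdeg hM hj)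

end Analytic

end Literature.NumberTheory.Irrationality.LaiLupuSprang2025

end
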